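import Literature.NumberTheory.LFunctions.ZeroDensityNearOne
import HarnessLib

/-!
# `N(σ, T) = 0` in the Vinogradov–Korobov region

NOT RH-BEARING. A zero-free region / density statement counts zeros off the critical line, it never
empties the strip (`Literature.Barriers.RiemannHypothesis.LindelofBacklund`); everything here is
RH-FREE literature. bears_on: LADDER-RH §4 HELD row `DensityLadder` (corpus C4, §13.2 inputs).
Nothing here bears on the truth of RH.

Topic `Literature/NumberTheory/LFunctions`. Pure-proof file (theorems only; no definition, no
named fact). The step of Guth–Maynard §13.2 (arXiv:2405.20552, proof of Cor. 1.3, third display):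
"Using this and the Vinogradov-Korobov zero-free bound `N(σ,T) = 0` for
`σ ≥ 1 − c(log T)^{−2/3}(log log T)^{−1/3}` for a suitable constant `c > 0` (see [M3])", for the
tree's counting function `N(σ, T) = zetaZeroCountRe σ T` (zeros `β + iγ`, `β ≥ σ`, `0 < γ ≤ T`,
with multiplicity). The zero-free region itself is the tree's (PROVED, standard axioms)
`VKFromRichert.zeta_zeroFree_of_richertType` fed with `exists_richertTypeBound_one`
(`ZeroDensityNearOne.lean`): `ζ(s) ≠ 0` for `|Im s| ≥ 21`,
`Re s ≥ 1 − c₁/((log|Im s|)^{2/3}(log log|Im s|)^{1/3})`. Passing from "each zero of height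
`≥ 21`" to "the box `β ≥ σ`, `0 < γ ≤ T` is empty" needs two bookkeeping facts, supplied here:
the threshold `c/((log t)^{2/3}(log log t)^{1/3})` is non-increasing in `t ≥ 21`, and the finitely
many zeros of height `< 21` have real parts `≤ 1 − c₀ < 1` (`zetaZeroBox_finite`, each zero off the
real axis having `β < 1`).

* `exists_re_le_one_sub_of_im_le` — `∃ c₀ > 0`, every zero with `0 < γ ≤ 21` has `β ≤ 1 − c₀`;
* `vkThreshold_pos`, `vkThreshold_mono` — positivity/monotonicity of `(log t)^{2/3}(log log t)^{1/3}`;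
* `exists_re_lt_of_vkRegion` (parametric in a zero-free region of the printed shape) and
  `exists_re_lt_vk` (unconditional): `∃ c > 0, T₀: ∀ T ≥ T₀`, every zero with `0 < γ ≤ T` has
  `β < 1 − c/((log T)^{2/3}(log log T)^{1/3})`;
* `zetaZeroBox_eq_empty_vk`, `zetaZeroCountRe_eq_zero_vk` — hence the box is empty and
  `N(σ, T) = 0` for `σ ≥ 1 − c/((log T)^{2/3}(log log T)^{1/3})`, `T ≥ T₀`.

Consumers: the zero-sum decay of §13.2 (Cor. 1.3/1.4, `GuthMaynardZeroSumDecay.lean`) and the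
near-one density discharge (`ZeroDensityNearOneProofs.lean`, regime `1 − σ < η_vk(T)`).

## References

* L. Guth, J. Maynard, Ann. of Math. (2) 203 (2026) 623–675 = arXiv:2405.20552, §13.2 (third
  display of the proof of Cor. 1.3). [GuthMaynard2026]
* E. C. Titchmarsh, *The Theory of the Riemann Zeta-Function*, 2nd ed. (1986), Theorem 3.10,
  §6.19 (the Vinogradov–Korobov region, as formalised in `VinogradovKorobovFromRichert.lean`).
  [Titchmarsh1986]
-/

noncomputable section

open Complex

namespace Literature.NumberTheory.LFunctions

namespace VKCount

/-- The Vinogradov–Korobov denominator `(log t)^{2/3} (log log t)^{1/3}` (written inline below) is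
positive for `t ≥ 21` (`log 21 > 1`, so `log log 21 > 0`). [cite: Titchmarsh1986, §6.19] -/
theorem vkThreshold_pos {t : ℝ} (ht : 21 ≤ t) :
    0 < Real.log t ^ (2 / 3 : ℝ) * Real.log (Real.log t) ^ (1 / 3 : ℝ) := by
  have h1 : 1 < Real.log t := by
    rw [Real.lt_log_iff_exp_lt (by linarith)]
    have := Real.exp_one_lt_d9
    linarith
  have h2 : 0 < Real.log (Real.log t) := Real.log_pos h1
  have h3 : 0 < Real.log t := by linarith
  positivity

/-- Monotonicity of the denominator: for `21 ≤ t ≤ T`,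
`(log t)^{2/3}(log log t)^{1/3} ≤ (log T)^{2/3}(log log T)^{1/3}`. [cite: Titchmarsh1986, §6.19] -/
theorem vkThreshold_mono {t T : ℝ} (ht : 21 ≤ t) (htT : t ≤ T) :
    Real.log t ^ (2 / 3 : ℝ) * Real.log (Real.log t) ^ (1 / 3 : ℝ)
      ≤ Real.log T ^ (2 / 3 : ℝ) * Real.log (Real.log T) ^ (1 / 3 : ℝ) := by
  have ht0 : 0 < t := by linarith
  have h1 : 1 < Real.log t := by
    rw [Real.lt_log_iff_exp_lt ht0]
    have := Real.exp_one_lt_d9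
    linarith
  have hlog : Real.log t ≤ Real.log T := Real.log_le_log ht0 htT
  have hloglog : Real.log (Real.log t) ≤ Real.log (Real.log T) :=
    Real.log_le_log (by linarith) hlog
  have h2 : 0 ≤ Real.log (Real.log t) := (Real.log_pos h1).le
  have hlogT : 0 ≤ Real.log T := by linarith
  apply mul_le_mul
  · exact Real.rpow_le_rpow (by linarith) hlog (by norm_num)
  · exact Real.rpow_le_rpow h2 hloglog (by norm_num)
  · exact Real.rpow_nonneg h2 _
  · exact Real.rpow_nonneg hlogT _

/-- **The zeros of small height stay away from `Re s = 1`**: there is `c₀ > 0` such that every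
zero `ρ` of `ζ` with `0 < Im ρ ≤ 21` has `Re ρ ≤ 1 − c₀`. (The box `zetaZeroBox 0 21` is finite,
`zetaZeroBox_finite`, and each of its elements has `Re ρ < 1`, `riemannZeta_ne_zero_of_one_le_re`;
take the maximum.) This is the input "for a suitable constant `c > 0`" needs at bounded height.
[cite: GuthMaynard2026, §13.2 (proof of Cor. 1.3, the Vinogradov–Korobov step)] -/
theorem exists_re_le_one_sub_of_im_le :
    ∃ c₀ : ℝ, 0 < c₀ ∧ ∀ ρ : ℂ, riemannZeta ρ = 0 → 0 < ρ.im → ρ.im ≤ 21 → ρ.re ≤ 1 - c₀ := by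
  classical
  set F : Finset ℂ := (zetaZeroBox_finite 0 21).toFinset with hF
  have hmem : ∀ ρ : ℂ, riemannZeta ρ = 0 → 0 < ρ.im → ρ.im ≤ 21 → ρ ∈ F := by
    intro ρ h0 h1 h2
    rw [hF, Set.Finite.mem_toFinset]
    have h := re_mem_Ioo_of_riemannZeta_eq_zero_of_im_ne_zero h0 h1.ne'
    exact ⟨h0, h.1.le, h.2.le, h1, h2⟩
  by_cases hne : F.Nonempty
  · obtain ⟨ρ₀, hρ₀, hmax⟩ := F.exists_max_image (fun ρ : ℂ => ρ.re) hne
    have hρ₀' : ρ₀ ∈ zetaZeroBox 0 21 := by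
      rw [hF, Set.Finite.mem_toFinset] at hρ₀
      exact hρ₀
    obtain ⟨h0, -, -, h3, -⟩ := hρ₀'
    have hlt : ρ₀.re < 1 := (re_mem_Ioo_of_riemannZeta_eq_zero_of_im_ne_zero h0 h3.ne').2
    refine ⟨1 - ρ₀.re, by linarith, fun ρ h0 h1 h2 => ?_⟩
    have := hmax ρ (hmem ρ h0 h1 h2)
    linarith
  · refine ⟨1, one_pos, fun ρ h0 h1 h2 => ?_⟩
    exact absurd ⟨ρ, hmem ρ h0 h1 h2⟩ hne

/-- **Every zero up to height `T` lies strictly left of the Vinogradov–Korobov curve at height `T`**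
(parametric form): if `ζ(s) ≠ 0` for `|Im s| ≥ 21` and
`Re s ≥ 1 − c₁/((log|Im s|)^{2/3}(log log|Im s|)^{1/3})` (`c₁ > 0`), then there are `c > 0` and `T₀`
such that for `T ≥ T₀` every zero `ρ` with `0 < Im ρ ≤ T` has
`Re ρ < 1 − c/((log T)^{2/3}(log log T)^{1/3})`. (Zeros of height `≥ 21`: the curve is
non-increasing in the height; zeros of height `< 21`: `Re ρ ≤ 1 − c₀` and `c ≤ c₀/2`.)
[cite: GuthMaynard2026, §13.2 (proof of Cor. 1.3, "N(σ,T) = 0 for σ ≥ 1 − c(log T)^{−2/3}(log log T)^{−1/3}")] -/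
theorem exists_re_lt_of_vkRegion {c₁ : ℝ} (hc₁ : 0 < c₁)
    (hVK : ∀ s : ℂ, 21 ≤ |s.im| →
      1 - c₁ / (Real.log |s.im| ^ (2 / 3 : ℝ) * Real.log (Real.log |s.im|) ^ (1 / 3 : ℝ)) ≤ s.re →
        riemannZeta s ≠ 0) :
    ∃ c : ℝ, 0 < c ∧ ∃ T₀ : ℝ, ∀ T : ℝ, T₀ ≤ T → ∀ ρ : ℂ, riemannZeta ρ = 0 → 0 < ρ.im →
      ρ.im ≤ T → ρ.re < 1 - c / (Real.log T ^ (2 / 3 : ℝ) * Real.log (Real.log T) ^ (1 / 3 : ℝ)) := by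
  obtain ⟨c₀, hc₀, hsmall⟩ := exists_re_le_one_sub_of_im_le
  refine ⟨min (c₁ / 2) (c₀ / 2), lt_min (by linarith) (by linarith), Real.exp (Real.exp 1),
    fun T hT ρ h0 h1 h2 => ?_⟩
  set c : ℝ := min (c₁ / 2) (c₀ / 2) with hc
  have hcc₁ : c < c₁ := lt_of_le_of_lt (min_le_left _ _) (by linarith)
  have hcc₀ : c < c₀ := lt_of_le_of_lt (min_le_right _ _) (by linarith)
  have hcpos : 0 < c := lt_min (by linarith) (by linarith)
  -- `T ≥ e^e ≥ 21`? No: `e^e ≈ 15.2`; we only need `log T ≥ e` and handle heights via cases.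
  have hT0 : 0 < T := lt_of_lt_of_le (Real.exp_pos _) hT
  have hlogT : Real.exp 1 ≤ Real.log T := by
    rw [Real.le_log_iff_exp_le hT0]
    exact hT
  have hlogT1 : 1 ≤ Real.log T := le_trans (by linarith [Real.add_one_le_exp (1 : ℝ)]) hlogT
  have hloglogT : 1 ≤ Real.log (Real.log T) := by
    rw [Real.le_log_iff_exp_le (by linarith)]
    exact hlogT
  -- the denominator at `T` is `≥ 1`
  set D : ℝ := Real.log T ^ (2 / 3 : ℝ) * Real.log (Real.log T) ^ (1 / 3 : ℝ) with hD
  have hD1 : 1 ≤ D := by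
    have h1 : 1 ≤ Real.log T ^ (2 / 3 : ℝ) := Real.one_le_rpow hlogT1 (by norm_num)
    have h2 : 1 ≤ Real.log (Real.log T) ^ (1 / 3 : ℝ) := Real.one_le_rpow hloglogT (by norm_num)
    nlinarith
  have hD0 : 0 < D := by linarith
  rcases lt_or_ge ρ.im 21 with hlow | hhigh
  · -- small height: `Re ρ ≤ 1 − c₀ < 1 − c ≤ 1 − c/D`
    have hρ := hsmall ρ h0 h1 hlow.le
    have hcD : c / D ≤ c := div_le_self hcpos.le hD1
    linarith
  · -- large height: the VK curve at height `γ` is at least the curve at height `T`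
    have habs : |ρ.im| = ρ.im := abs_of_pos h1
    set Dρ : ℝ := Real.log ρ.im ^ (2 / 3 : ℝ) * Real.log (Real.log ρ.im) ^ (1 / 3 : ℝ) with hDρ
    have hDρ0 : 0 < Dρ := vkThreshold_pos hhigh
    have hDρD : Dρ ≤ D := vkThreshold_mono hhigh h2
    by_contra hge
    rw [not_lt] at hge
    -- `1 − c₁/Dρ ≤ 1 − c/D ≤ Re ρ`
    have h3 : c / D ≤ c₁ / Dρ := by
      calc c / D ≤ c / Dρ := div_le_div_of_nonneg_left hcpos.le hDρ0 hDρD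
        _ ≤ c₁ / Dρ := div_le_div_of_nonneg_right hcc₁.le hDρ0.le
    have h4 : 1 - c₁ / Dρ ≤ ρ.re := by linarith
    have h5 := hVK ρ (by rw [habs]; exact hhigh) (by rw [habs]; exact h4)
    exact h5 h0

/-- **Unconditional form**: there are `c > 0` and `T₀` such that for all `T ≥ T₀` every zero `ρ` of
`ζ` with `0 < Im ρ ≤ T` satisfies `Re ρ < 1 − c/((log T)^{2/3}(log log T)^{1/3})` — from the tree's
Vinogradov–Korobov region `VKFromRichert.zeta_zeroFree_of_richertType` with the unconditional
Richert-type bound `exists_richertTypeBound_one` (standard axioms).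
[cite: GuthMaynard2026, §13.2 (proof of Cor. 1.3, the Vinogradov–Korobov step)]
[cite: Titchmarsh1986, Theorem 3.10 and §6.19] -/
theorem exists_re_lt_vk :
    ∃ c : ℝ, 0 < c ∧ ∃ T₀ : ℝ, ∀ T : ℝ, T₀ ≤ T → ∀ ρ : ℂ, riemannZeta ρ = 0 → 0 < ρ.im →
      ρ.im ≤ T → ρ.re < 1 - c / (Real.log T ^ (2 / 3 : ℝ) * Real.log (Real.log T) ^ (1 / 3 : ℝ)) := by
  obtain ⟨A, B, -, hB, hR⟩ := exists_richertTypeBound_one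
  obtain ⟨c₁, hc₁, hVK⟩ := VKFromRichert.zeta_zeroFree_of_richertType hR (by norm_num)
  exact exists_re_lt_of_vkRegion hc₁ hVK

/-- **The box above the Vinogradov–Korobov curve is empty**: with `c, T₀` of `exists_re_lt_vk`, for
`T ≥ T₀` and `σ ≥ 1 − c/((log T)^{2/3}(log log T)^{1/3})`, `zetaZeroBox σ T = ∅`.
[cite: GuthMaynard2026, §13.2 (proof of Cor. 1.3, "N(σ,T) = 0 for σ ≥ 1 − c(log T)^{−2/3}(log log T)^{−1/3}")] -/
theorem zetaZeroBox_eq_empty_vk :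
    ∃ c : ℝ, 0 < c ∧ ∃ T₀ : ℝ, ∀ T : ℝ, T₀ ≤ T → ∀ σ : ℝ,
      1 - c / (Real.log T ^ (2 / 3 : ℝ) * Real.log (Real.log T) ^ (1 / 3 : ℝ)) ≤ σ →
        zetaZeroBox σ T = ∅ := by
  obtain ⟨c, hc, T₀, h⟩ := exists_re_lt_vk
  refine ⟨c, hc, T₀, fun T hT σ hσ => ?_⟩
  ext ρ
  simp only [Set.mem_empty_iff_false, iff_false]
  rintro ⟨h0, h1, -, h3, h4⟩
  have := h T hT ρ h0 h3 h4
  linarith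

/-- **`N(σ, T) = 0` in the Vinogradov–Korobov region** (Guth–Maynard §13.2: "the Vinogradov-Korobov
zero-free bound `N(σ,T) = 0` for `σ ≥ 1 − c(log T)^{−2/3}(log log T)^{−1/3}` for a suitable constant
`c > 0`"), for the tree's `zetaZeroCountRe` and all `T ≥ T₀`.
[cite: GuthMaynard2026, §13.2 (proof of Cor. 1.3, "N(σ,T) = 0 for σ ≥ 1 − c(log T)^{−2/3}(log log T)^{−1/3}")] -/
theorem zetaZeroCountRe_eq_zero_vk :
    ∃ c : ℝ, 0 < c ∧ ∃ T₀ : ℝ, ∀ T : ℝ, T₀ ≤ T → ∀ σ : ℝ,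
      1 - c / (Real.log T ^ (2 / 3 : ℝ) * Real.log (Real.log T) ^ (1 / 3 : ℝ)) ≤ σ →
        zetaZeroCountRe σ T = 0 := by
  obtain ⟨c, hc, T₀, h⟩ := zetaZeroBox_eq_empty_vk
  refine ⟨c, hc, T₀, fun T hT σ hσ => ?_⟩
  simp [zetaZeroCountRe, h T hT σ hσ]

end VKCount

end Literature.NumberTheory.LFunctions
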